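import Literature.NumberTheory.GelbartRogawski1991.UnitaryDualPairThetaKernelCMTwist
import Literature.NumberTheory.GelbartRogawski1991.UnitaryDualPairThetaKernelCMKType
import Literature.NumberTheory.Automorphic.UnitaryGroupArchIsotropyTwist
import HarnessLib

/-!
# The `K_∞`-type of the CM dual pair's Weil representation under the normalisation `s_pair ⊗ η`, and the
# normalised theta-kernel datum with its `K`-type pinned (`N = 3`)

Companion of `UnitaryDualPairThetaKernelCMTwist` (the normalised pair splitting `cmPairSplittingTwist hGR η` and its
Weil representation `cmPairRepTwist hGR η = η • (ω_ψ ∘ s_pair)`) and of `UnitaryDualPairThetaKernelCMKType` (the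
`χ`-isotypic `K_∞`-type `cmKType` of `ω_ψ ∘ s_pair` for `K_∞ × 1` acting through the frame transport `cmKTypeHom`).
Since the normalised action is the original one multiplied by the scalar `η`, **the `χ′`-isotypic `K_∞`-type of
`ω_ψ ∘ (s_pair ⊗ η)` is the `χ′ / (η ∘ (cmKTypeHom, 1))`-isotypic `K_∞`-type of `ω_ψ ∘ s_pair`**
(`cmKTypeTwist_eq_cmKType`, an instance of `UnitaryGroup.kappaIsotypic_smul_twist'` of
`UnitaryGroupArchIsotropyTwist`) — the bookkeeping by which a `K_∞`-type prescribed in one normalisation of the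
splitting (e.g. Fock-model data, [KonnoKonno2007]) is located in another ([GelbartRogawski1991, §3.1 Remark p. 457
L4–13]: compatible splittings differ by automorphic characters into the central `ℂ*`).  The normalised `K`-type is
stable under `1 × U(diag dW)(𝔸)` (`cmKTypeTwist_stable`), so Weil's theta-kernel datum in the normalised splitting
can be PINNED to it: `cmThetaKernelDatumTwistK` (+ the `rfl`-level API `_s`, `_act`, `_SK`, `_thetaFun_mk`,
`_thetaFun_mul_right`).

Kernel only; 0 records; 0 named facts.
-/

noncomputable section

open scoped Matrix
open NumberField
open Literature.NumberTheory.Automorphic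
open Literature.NumberTheory.Weil1964
open Literature.Geometry.ComplexHyperbolic

namespace Literature.NumberTheory.GelbartRogawski1991

namespace UnitaryDualPair

/-! ## §3. The `χ′`-isotypic `K_∞`-type in the normalised splitting (`N = 3`) and the pinned datum -/

section KType

variable (L : Type) [Field L] [NumberField L] [IsCMField L] {M n : ℕ} (e : Fin 3 × Fin M ≃ Fin n)
variable (dV : Fin 3 → L) (hdV : ∀ i, IsCMField.complexConj L (dV i) = dV i) (hdV0 : ∀ i, dV i ≠ 0)
variable (dW : Fin M → L) (hdW : ∀ i, IsCMField.complexConj L (dW i) = dW i) (hdW0 : ∀ i, dW i ≠ 0)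
variable (hGR : (cmSplittingDatum L e dV hdV hdV0 dW hdW hdW0).CompatibleSplitting)
variable (η : CMAdelic L dV × CMAdelic L dW →* ℂˣ)
  (hρ : HasThetaMajorants fun (p : CMAdelic L dV × CMAdelic L dW) (Φ : CMSchwartz L n) =>
    adelicMpCont.omega (↥(maximalRealSubfield L)) (Fin n) (CMGram L e dV hdV dW hdW)
      (cmPairSplitting L e dV hdV hdV0 dW hdW hdW0 hGR p) Φ)
  (hηc : Continuous fun p => ((η p : ℂˣ) : ℂ))
  (hη : ∀ γU ∈ CMRat L dV, ∀ γ ∈ CMRat L dW, η (γU, γ) = 1)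
variable (H : Matrix (Fin 3) (Fin 3) L) (g : GL (Fin 3) L)
  (hg : ((g : Matrix (Fin 3) (Fin 3) L).map (cmConjRingHom L))ᵀ * H * (g : Matrix (Fin 3) (Fin 3) L) =
    Matrix.diagonal dV)
  (τ : L →+* ℂ) (T : GL (Fin 3) ℂ) (hT : formCongr (starRingEnd ℂ) T (H.map τ) = BallModel.J)
  (χ' : ↥(UnitaryGroup.archIsotropy L H τ T hT) →* ℂˣ)

/-- **the `χ′`-isotypic `K`-type of the NORMALISED representation** `ω_ψ ∘ (s_pair ⊗ η)` for `K_∞ × 1` acting through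
the frame transport `cmKTypeHom` (`UnitaryGroup.kappaIsotypic`). [folklore] -/
def cmKTypeTwist : Submodule ℂ (CMSchwartz L n) :=
  UnitaryGroup.kappaIsotypic (cmPairRepTwist L e dV hdV hdV0 dW hdW hdW0 hGR η) (cmKTypeHom L H g dV hg) χ'

/-- `cmKTypeTwist` IS `kappaIsotypic` of the normalised representation (definitional). [folklore] -/
theorem cmKTypeTwist_eq :
    cmKTypeTwist L e dV hdV hdV0 dW hdW hdW0 hGR η H g hg τ T hT χ' =
      UnitaryGroup.kappaIsotypic (cmPairRepTwist L e dV hdV hdV0 dW hdW hdW0 hGR η) (cmKTypeHom L H g dV hg) χ' := rfl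

/-- **`K`-types under the normalisation**: the `χ′`-isotypic `K`-type of `ω_ψ ∘ (s_pair ⊗ η)` is the
`χ′ / (η ∘ (cmKTypeHom, 1))`-isotypic `K`-type of `ω_ψ ∘ s_pair` (`UnitaryGroup.kappaIsotypic_smul_twist'`) — the
bookkeeping locating a `K_∞`-type prescribed in one normalisation inside the other. [folklore] -/
theorem cmKTypeTwist_eq_cmKType :
    cmKTypeTwist L e dV hdV hdV0 dW hdW hdW0 hGR η H g hg τ T hT χ' =
      cmKType L e dV hdV hdV0 dW hdW hdW0 hGR H g hg τ T hT
        (χ' / UnitaryGroup.kappaTwistChar η (cmKTypeHom L H g dV hg)) :=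
  UnitaryGroup.kappaIsotypic_smul_twist' _ _ η
    (fun p Φ => cmPairRepTwist_apply_eq_smul L e dV hdV hdV0 dW hdW hdW0 hGR η p Φ) _ χ'

/-- Membership in the normalised `K`-type. [folklore] -/
theorem mem_cmKTypeTwist_iff (Φ : CMSchwartz L n) :
    Φ ∈ cmKTypeTwist L e dV hdV hdV0 dW hdW hdW0 hGR η H g hg τ T hT χ' ↔
      ∀ k : ↥(UnitaryGroup.archIsotropy L H τ T hT),
        cmPairRepTwist L e dV hdV hdV0 dW hdW hdW0 hGR η
            (cmKTypeHom L H g dV hg (UnitaryGroup.archIsotropyToAdelic L H τ T hT k), 1) Φ = (χ' k : ℂ) • Φ :=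
  UnitaryGroup.mem_kappaIsotypic_iff _ _ _ _

/-- **stability of the normalised `K`-type under `1 × U(diag dW)(𝔸)`** — the `hSK` clause of
`cmThetaKernelDatumTwist`, `Set`-level. [folklore] -/
theorem cmKTypeTwist_stable :
    ∀ (h : CMAdelic L dW) (Φ : CMSchwartz L n),
      Φ ∈ (cmKTypeTwist L e dV hdV hdV0 dW hdW hdW0 hGR η H g hg τ T hT χ' : Set (CMSchwartz L n)) →
        cmPairRepTwist L e dV hdV hdV0 dW hdW hdW0 hGR η (1, h) Φ ∈
          (cmKTypeTwist L e dV hdV hdV0 dW hdW hdW0 hGR η H g hg τ T hT χ' : Set (CMSchwartz L n)) :=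
  UnitaryGroup.kappaIsotypic_stable_inr' _ _ _

/-- **WEIL'S THETA-KERNEL DATUM OF THE CM DUAL PAIR IN THE NORMALISED SPLITTING WITH ITS `K`-TYPE PINNED** to the
`χ′`-isotypic subspace: `cmThetaKernelDatumTwist hGR η hρ hηc hη (cmKTypeTwist …) (cmKTypeTwist_stable …)`.
[cite: Weil1964, Chap. III n° 41 Thm 6 p. 193] -/
def cmThetaKernelDatumTwistK :=
  cmThetaKernelDatumTwist L e dV hdV hdV0 dW hdW hdW0 hGR η hρ hηc hη
    (cmKTypeTwist L e dV hdV hdV0 dW hdW hdW0 hGR η H g hg τ T hT χ' : Set (CMSchwartz L n))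
    (cmKTypeTwist_stable L e dV hdV hdV0 dW hdW hdW0 hGR η H g hg τ T hT χ')

/-- the lift of the pinned normalised CM datum is the identity. [folklore] -/
theorem cmThetaKernelDatumTwistK_s :
    (cmThetaKernelDatumTwistK L e dV hdV hdV0 dW hdW hdW0 hGR η hρ hηc hη H g hg τ T hT χ').s = MonoidHom.id _ := rfl

/-- the Weil action of the pinned normalised CM datum: `W.act p Φ = η(p) • ω_ψ(s_pair p) Φ`.
[cite: Weil1964, Chap. III n° 41 p. 193] -/
theorem cmThetaKernelDatumTwistK_act (p : CMAdelic L dV × CMAdelic L dW) (Φ : CMSchwartz L n) :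
    (cmThetaKernelDatumTwistK L e dV hdV hdV0 dW hdW hdW0 hGR η hρ hηc hη H g hg τ T hT χ').W.act p Φ =
      ((η p : ℂˣ) : ℂ) • cmPairRep L e dV hdV hdV0 dW hdW hdW0 hGR p Φ :=
  cmPairRepTwist_apply_eq_smul L e dV hdV hdV0 dW hdW hdW0 hGR η p Φ

/-- the `K`-type set of the pinned normalised CM datum is `cmKTypeTwist`. [folklore] -/
theorem cmThetaKernelDatumTwistK_SK :
    (cmThetaKernelDatumTwistK L e dV hdV hdV0 dW hdW hdW0 hGR η hρ hηc hη H g hg τ T hT χ').SK =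
      (cmKTypeTwist L e dV hdV hdV0 dW hdW hdW0 hGR η H g hg τ T hT χ' : Set (CMSchwartz L n)) := rfl

/-- the theta kernel of the pinned normalised CM datum: `θ_Φ(x, h) = Θ(ω_ψ((s_pair ⊗ η)(x⁻¹, h⁻¹)) Φ)`.
[cite: Weil1964, Chap. III n° 41 Thm 6 p. 193] -/
theorem cmThetaKernelDatumTwistK_thetaFun_mk (Φ : CMSchwartz L n) (x : CMAdelic L dV) (h : CMAdelic L dW) :
    (cmThetaKernelDatumTwistK L e dV hdV hdV0 dW hdW hdW0 hGR η hρ hηc hη H g hg τ T hT χ').thetaFun Φ (x, h) =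
      thetaDistLM (↥(maximalRealSubfield L)) (Fin n)
        (cmPairRepTwist L e dV hdV hdV0 dW hdW hdW0 hGR η (x⁻¹, h⁻¹) Φ) := rfl

/-- the theta kernel of the pinned normalised CM datum is right-invariant under the rational points.
[cite: Weil1964, Chap. III n° 41 Thm 6 p. 193] -/
theorem cmThetaKernelDatumTwistK_thetaFun_mul_right (Φ : CMSchwartz L n) (p : CMAdelic L dV × CMAdelic L dW)
    {γU : CMAdelic L dV} (hγU : γU ∈ CMRat L dV) {γ : CMAdelic L dW} (hγ : γ ∈ CMRat L dW) :
    (cmThetaKernelDatumTwistK L e dV hdV hdV0 dW hdW hdW0 hGR η hρ hηc hη H g hg τ T hT χ').thetaFun Φ (p * (γU, γ)) =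
      (cmThetaKernelDatumTwistK L e dV hdV hdV0 dW hdW hdW0 hGR η hρ hηc hη H g hg τ T hT χ').thetaFun Φ p :=
  (cmThetaKernelDatumTwistK L e dV hdV hdV0 dW hdW hdW0 hGR η hρ hηc hη H g hg τ T hT χ').thetaFun_mul_right Φ p hγU hγ

end KType

end UnitaryDualPair

end Literature.NumberTheory.GelbartRogawski1991

end

/-! ### Build-lane note (ops-buildfix G11b-3 recipe v2, LEDGER B13-1/B14-5/B14-7, 2026-08-22)
`lean -o` (the hub build lane, never `lean`/the gate check) runs Lean 4.32's library-suggestion indexers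
(`Lean.LibrarySuggestions.SymbolFrequency` / `SineQuaNon`, from their `exportEntriesFn`) over the statement of every local
theorem constant that is not a denied premise; on this family's statements (very large dependent binder telescopes) that fold
runs for tens of minutes (incident G11b-3, run/shared/lean/ops/buildfix/G11b-3-DOSSIER.md). `isDeniedPremise` skips
`[implicit_reducible]` constants before any fold, and the status is inert on theorems (Meta never unfolds `thmInfo`).
v2 form: ONE file-final, top-level `local` attribute — it goes through the synchronous scoped reducibility extension that
`getReducibilityStatusCore` reads first, so it needs no `set_option Elab.async false` (parallel elaboration stays on), also
reaches auto-realized `*.congr_simp` / structure-projection theorem constants, is never popped before export, and is not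
exported. No statement or proof is changed. -/
set_option allowUnsafeReducibility true in
attribute [local implicit_reducible]
  Literature.NumberTheory.GelbartRogawski1991.UnitaryDualPair.cmKTypeTwist_eq
  Literature.NumberTheory.GelbartRogawski1991.UnitaryDualPair.cmKTypeTwist_eq_cmKType
  Literature.NumberTheory.GelbartRogawski1991.UnitaryDualPair.mem_cmKTypeTwist_iff
  Literature.NumberTheory.GelbartRogawski1991.UnitaryDualPair.cmKTypeTwist_stable
  Literature.NumberTheory.GelbartRogawski1991.UnitaryDualPair.cmThetaKernelDatumTwistK_s
  Literature.NumberTheory.GelbartRogawski1991.UnitaryDualPair.cmThetaKernelDatumTwistK_act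
  Literature.NumberTheory.GelbartRogawski1991.UnitaryDualPair.cmThetaKernelDatumTwistK_SK
  Literature.NumberTheory.GelbartRogawski1991.UnitaryDualPair.cmThetaKernelDatumTwistK_thetaFun_mk
  Literature.NumberTheory.GelbartRogawski1991.UnitaryDualPair.cmThetaKernelDatumTwistK_thetaFun_mul_right
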